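import Mathlib
import Summits.Ventures.HodgeRepro2.BallGroup

/-!
# T6B2Hodge — (B2-i): Liu's Hodge map at the matrix level, and its independence of the CM type

Liu, CJM 9 (2021), p. 108 ll. 4–26: «We define the Hodge map h_{V,Φ} : Res_{C/R} G_m → G_R to be the
one sending z ∈ C^× = (Res_{C/R} G_m)(R) to (diag(I_{p_{τ_1}}, (z/z̄) I_{q_{τ_1}}), ⋯,
diag(I_{p_{τ_d}}, (z/z̄) I_{q_{τ_d}})) ∈ G_R(R), where we identify G_R(R) as a subgroup of GL_n(C)^d via
{τ_1^−, …, τ_d^−}.» This file carries that tuple of matrices (`liuHodgeTuple`), one `n × n` block per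
real place `τ`, with `p τ` the number of `+1`'s of the signature at `τ` (so `q_τ = n − p τ`), and
proves the matrix-level content of TIER4 §B2.3 and §B2.6:
* at every real place with `q_τ = 0` the block is the identity (`liuHodgeTuple_eq_one_of_le`) — hence
  fixed by the coordinate change `τ^− ↔ τ^+` (`map_star_liuHodgeTuple_of_le`): this is the kernel
  part of Rem. C.2's «the Hodge map h_{V,Φ} … depend[s] only on Φ ∩ π^{−1}τ», TIER4 §B2.3 [P];
* for the `ϑ_1`-nearby signature `(2,1), (3,0), (3,0)` the tuple is `(diag(1, 1, z/z̄), I_3, I_3)`,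
  whose first block is seat p4's `BallGroup.hodge z` (`liuHodgeTuple_nearby`, `liuHodgeTuple_eq_one`);
* the conjugate datum of §B2.6: entrywise complex conjugation of the block at `z` is the block at `z̄`
  (`map_star_liuHodgeTuple`; p4's `hodge_map_star` is the `ϑ_1`-block case);
* `z ↦ h(z)` is multiplicative on `ℂ^×` blockwise (`liuHodgeTuple_mul`).
Nothing about the algebraic group `G`, the conjugacy class `X` or Shimura data is claimed here.
-/

namespace Summit.Ventures.HodgeRepro2.T6.B2Hodge

open Summit.Ventures.HodgeRepro2

variable {ι : Type*}

/-- Liu p. 108 ll. 4–26: the Hodge map `h_{V,Φ}(z) = (diag(I_{p_τ}, (z/z̄) I_{q_τ}))_τ` as a tuple of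
`n × n` complex matrices indexed by the real places `τ : ι`, in the coordinates `{τ^−}`; `p τ` is the
number of `+1`'s of the signature `(p_τ, q_τ)` of `V ⊗_{F,τ} ℝ` (so `q_τ = n − p τ`). -/
noncomputable def liuHodgeTuple (n : ℕ) (p : ι → ℕ) (z : ℂ) : ι → Matrix (Fin n) (Fin n) ℂ :=
  fun τ => Matrix.diagonal fun i : Fin n => if i.val < p τ then 1 else z / star z

/-- Unfolding lemma for `liuHodgeTuple`. -/
theorem liuHodgeTuple_apply (n : ℕ) (p : ι → ℕ) (z : ℂ) (τ : ι) :
    liuHodgeTuple n p z τ = Matrix.diagonal fun i : Fin n => if i.val < p τ then 1 else z / star z := rfl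

/-- At a real place with `q_τ = 0` (i.e. `p τ = n`, the definite places) the block is the identity
matrix — TIER4 §B2.3: «diag(I_{p_ϑ}, (z/z̄) I_{q_ϑ}) = I_3 when q_ϑ = 0». -/
theorem liuHodgeTuple_eq_one_of_le (n : ℕ) (p : ι → ℕ) (z : ℂ) (τ : ι) (h : n ≤ p τ) :
    liuHodgeTuple n p z τ = 1 := by
  rw [liuHodgeTuple_apply, ← Matrix.diagonal_one]
  congr 1
  ext i
  simp [lt_of_lt_of_le i.2 h]

/-- Entrywise complex conjugation of the block at `z` is the block at `z̄` — the CONJUGATE DATUM of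
TIER4 §B2.6, `h_{V,τ̄_1} = h_{V,τ_1} ∘ (z ↦ z̄)`, at every place (seat p4's `BallGroup.hodge_map_star`
is the `ϑ_1`-block). -/
theorem map_star_liuHodgeTuple (n : ℕ) (p : ι → ℕ) (z : ℂ) (τ : ι) :
    (liuHodgeTuple n p z τ).map star = liuHodgeTuple n p (star z) τ := by
  rw [liuHodgeTuple_apply, liuHodgeTuple_apply, Matrix.diagonal_map (star_zero ℂ)]
  congr 1
  ext i
  split_ifs <;> simp [star_div₀]

/-- Rem. C.2, kernel part: at a definite place the block does not depend on which of the two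
embeddings `τ^−`, `τ^+` above `τ` is used as the coordinate (the two readings differ by entrywise
conjugation, which fixes the identity) — TIER4 §B2.3 [P]. -/
theorem map_star_liuHodgeTuple_of_le (n : ℕ) (p : ι → ℕ) (z : ℂ) (τ : ι) (h : n ≤ p τ) :
    (liuHodgeTuple n p z τ).map star = liuHodgeTuple n p z τ := by
  rw [liuHodgeTuple_eq_one_of_le n p z τ h, Matrix.map_one star (star_zero ℂ) (star_one ℂ)]

/-- `z ↦ h(z)` is multiplicative on `ℂ^×`, blockwise. -/
theorem liuHodgeTuple_mul (n : ℕ) (p : ι → ℕ) {z w : ℂ} (hz : z ≠ 0) (hw : w ≠ 0) (τ : ι) :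
    liuHodgeTuple n p (z * w) τ = liuHodgeTuple n p z τ * liuHodgeTuple n p w τ := by
  simp only [liuHodgeTuple_apply, Matrix.diagonal_mul_diagonal]
  congr 1
  ext i
  have hz' : star z ≠ 0 := star_ne_zero.mpr hz
  have hw' : star w ≠ 0 := star_ne_zero.mpr hw
  split_ifs
  · simp
  · rw [star_mul', mul_div_mul_comm]

/-- The `ϑ_1`-nearby signature of TIER4 §B2.3: `(p, q) = (2, 1)` at `ϑ_1` gives the block
`diag(1, 1, z/z̄)` of Liu p. 108 ll. 13–24, which is seat p4's `BallGroup.hodge z`. -/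
theorem liuHodgeTuple_nearby (p : ι → ℕ) (z : ℂ) (τ : ι) (h : p τ = 2) :
    liuHodgeTuple 3 p z τ = BallGroup.hodge z := by
  rw [liuHodgeTuple_apply, BallGroup.hodge]
  congr 1
  ext i
  fin_cases i <;> simp [h]

/-- The `ϑ_1`-nearby signature of TIER4 §B2.3: `(p, q) = (3, 0)` at `ϑ_2`, `ϑ_3` gives the identity
block `I_3`. -/
theorem liuHodgeTuple_eq_one (p : ι → ℕ) (z : ℂ) (τ : ι) (h : p τ = 3) :
    liuHodgeTuple 3 p z τ = 1 :=
  liuHodgeTuple_eq_one_of_le 3 p z τ h.ge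

end Summit.Ventures.HodgeRepro2.T6.B2Hodge
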